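import Mathlib
import Summits.ValiantsHypothesis.ValiantsHypothesis.Theorems.BarrierLeverPartitionMinorsHitByVPHiddenStatesSymSyzygyVeronese

/-!
# Route BarrierLever — item `PartitionMinorsHitByVP` (stmt-ValiantsHypothesis-19717), line `hidden_states`:
# THE SYM²-SYZYGY LAW AS A RANK BOUND — the deficiency of a pair block on rows of size ≤ 2q+1 is at least `C(|S| − M_q + 1, 2) − |S|`

Helper file (`--supports stmt-ValiantsHypothesis-19717`; cell valiant-natproofs, rung V4, 𝒟-side door (c), line `hidden_states`; prover seat
val-np-p3 gen 22; memo HOME/val-np-p3/g22/MEMO-girth-valnp3-g22.md §8–§10). Definition-free (three bundled linear maps are built inside the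
proof). Closes NO item. Completes `…HiddenStatesSymSyzygy{,Count,Veronese}`: those give ONE kernel vector (det = 0); this file counts them.

THE BOUND (`rank_add_le_card`). One table; states `S`, coordinates `T`, level `q`, `M_q := #{A ⊆ T : 1 ≤ |A| ≤ q}` (`verIdx`). If the column
family `e` (injective) contains the complete pair ball on `S` with its origin and every row `u i` lies in `B_{2q+1}(T)`, then the block-additive
matrix `[∏_{a∈u i}(tx none a + Σ_{p∈e k} tx (some p) a)]_{i,k}` (square, indexed by `n`) satisfies

  `rank + (C(|S| − M_q + 1, 2) − |S|) ≤ |n|`.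

Proof: the level-q syzygy space `Λ` has dimension `d ≥ |S| − M_q`; the coefficient functions `c : Sym2 (Fin d) → ℂ` with zero diagonal
`Σ_{i,j} c{i,j} v_i(p) v_j(p) = 0` form a space of dimension `≥ C(d+1,2) − |S|`; `c ↦ relVec(β_c)` is linear and INJECTIVE on it
(`SymSyzygy.relVec_ne_zero` + `symOf_eq_zero`) with image inside the kernel of the matrix (`mulVec_relVec_of_vanishing` +
`sum_secondDiff_eq_zero_veronese`); rank–nullity. For q = 1 (`M_1 = |T|`) this is the exact count `N_b − rank = C(b−t+1,2) − b` observed in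
all 52 computed single-block cases (kit j333612/j333642/j333755/j333811, n = t ≤ 20, b ≤ 40) — larger than the q = 1 pair-span law's count by b − t.

WHAT THIS IS NOT: an upper bound on rank only (exactness is empirical); nothing on joins; item 19717 OPEN; nothing on crux 14610 or VP ≠ VNP,
which is NOT proved.
-/

set_option linter.dupNamespace false

namespace Summit.ValiantsHypothesis.ValiantsHypothesis.Theorems.BarrierLever.HiddenStates

open Finset Matrix Module

noncomputable section

namespace SymSyzygy

variable {h K : ℕ} {n : Type*} [Fintype n]

/-- **THE SYM²-SYZYGY RANK BOUND (level q).** See the module docstring. -/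
theorem rank_add_le_card (tx : Option (Fin K) → Fin h → ℂ) (u : n → Finset (Fin h)) (e : n → Finset (Fin K))
    (he : Function.Injective e) (S : Finset (Fin K)) (T : Finset (Fin h)) (q : ℕ)
    (h0 : ∃ k, e k = ∅) (h1 : ∀ p ∈ S, ∃ k, e k = {p}) (h2 : ∀ p ∈ S, ∀ p' ∈ S, p ≠ p' → ∃ k, e k = insert p {p'})
    (hrows : ∀ i, u i ⊆ T ∧ (u i).card ≤ 2 * q + 1) :
    (Matrix.of fun i k : n => ∏ a ∈ u i, (tx none a + ∑ p ∈ e k, tx (some p) a)).rank +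
      (Nat.choose (S.card - (verIdx T q).card + 1) 2 - S.card) ≤ Fintype.card n := by
  classical
  set Mx := (Matrix.of fun i k : n => ∏ a ∈ u i, (tx none a + ∑ p ∈ e k, tx (some p) a)) with hMx
  -- the level-q syzygy space and a basis
  set Λ := LinearMap.ker (verMat tx S T q).mulVecLin with hΛ
  set d := finrank ℂ Λ with hd
  have hdle : S.card - (verIdx T q).card ≤ d := le_finrank_ker_ver tx S T q
  let bΛ : Basis (Fin d) ℂ Λ := Module.finBasis ℂ Λ
  let v : Fin d → (↥S → ℂ) := fun i => (bΛ i : ↥S → ℂ)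
  have hv : LinearIndependent ℂ v := bΛ.linearIndependent.map' Λ.subtype Λ.ker_subtype
  have hvΛ : ∀ i, ∀ A : ↥(verIdx T q), ∑ p : ↥S, (∏ a ∈ (A : Finset (Fin h)), tx (some (p : Fin K)) a) * v i p = 0 := by
    intro i A
    have hmem : (v i) ∈ Λ := (bΛ i).2
    rw [hΛ, LinearMap.mem_ker] at hmem
    have := congrFun hmem A
    simpa [Matrix.mulVecLin_apply, Matrix.mulVec, dotProduct, verMat] using this
  -- the diagonal map and its kernel
  let Δ : (Sym2 (Fin d) → ℂ) →ₗ[ℂ] (↥S → ℂ) :=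
    { toFun := fun c p => ∑ i, ∑ j, c s(i, j) * v i p * v j p
      map_add' := by
        intro c c'; funext p
        simp only [Pi.add_apply, add_mul, Finset.sum_add_distrib]
      map_smul' := by
        intro r c; funext p
        simp only [Pi.smul_apply, smul_eq_mul, RingHom.id_apply, Finset.mul_sum]
        refine Finset.sum_congr rfl fun i _ => Finset.sum_congr rfl fun j _ => by ring }
  have hkerΔ : Fintype.card (Sym2 (Fin d)) ≤ finrank ℂ (LinearMap.ker Δ) + S.card := by
    have h₁ := Δ.finrank_range_add_finrank_ker
    have h₂ : finrank ℂ (LinearMap.range Δ) ≤ finrank ℂ (↥S → ℂ) := Submodule.finrank_le _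
    rw [Module.finrank_fintype_fun_eq_card] at h₁ h₂
    rw [Fintype.card_coe] at h₂
    omega
  have hcardSym : Nat.choose (S.card - (verIdx T q).card + 1) 2 ≤ Fintype.card (Sym2 (Fin d)) := by
    rw [Sym2.card, Fintype.card_fin]; exact Nat.choose_le_choose 2 (by omega)
  -- the three linear maps c ↦ β_c ↦ extended β ↦ relation vector
  let L1 : (Sym2 (Fin d) → ℂ) →ₗ[ℂ] (↥S → ↥S → ℂ) :=
    { toFun := fun c => symOf S v c
      map_add' := by
        intro c c'; funext p p'
        simp only [symOf, Pi.add_apply, add_mul, Finset.sum_add_distrib]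
      map_smul' := by
        intro r c; funext p p'
        simp only [symOf, Pi.smul_apply, smul_eq_mul, RingHom.id_apply, Finset.mul_sum]
        refine Finset.sum_congr rfl fun i _ => Finset.sum_congr rfl fun j _ => by ring }
  let L2 : (↥S → ↥S → ℂ) →ₗ[ℂ] (Fin K → Fin K → ℂ) :=
    { toFun := fun β => extendβ S β
      map_add' := by
        intro β β'; funext p p'
        simp only [extendβ, Pi.add_apply]
        split_ifs <;> simp
      map_smul' := by
        intro r β; funext p p'
        simp only [extendβ, Pi.smul_apply, smul_eq_mul, RingHom.id_apply]
        split_ifs <;> simp }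
  let L3 : (Fin K → Fin K → ℂ) →ₗ[ℂ] (n → ℂ) :=
    { toFun := fun β => relVec e S β
      map_add' := by
        intro β β'; funext k
        simp only [relVec, Pi.add_apply, add_mul, Finset.sum_add_distrib]
      map_smul' := by
        intro r β; funext k
        simp only [relVec, Pi.smul_apply, smul_eq_mul, RingHom.id_apply, Finset.mul_sum]
        refine Finset.sum_congr rfl fun p _ => Finset.sum_congr rfl fun p' _ => by ring }
  let L : ↥(LinearMap.ker Δ) →ₗ[ℂ] (n → ℂ) := (L3.comp (L2.comp L1)).comp (LinearMap.ker Δ).subtype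
  -- facts about β_c for c in the kernel of Δ
  have hsymβ : ∀ c : Sym2 (Fin d) → ℂ, ∀ p ∈ S, ∀ p' ∈ S, extendβ S (symOf S v c) p p' = extendβ S (symOf S v c) p' p := by
    intro c p hp p' hp'
    simp only [extendβ, dif_pos hp, dif_pos hp']
    exact symOf_symm S v c _ _
  have hdiagβ : ∀ c : ↥(LinearMap.ker Δ), ∀ p ∈ S, extendβ S (symOf S v (c : Sym2 (Fin d) → ℂ)) p p = 0 := by
    intro c p hp
    have hc : Δ c = 0 := LinearMap.mem_ker.mp c.2
    have := congrFun hc ⟨p, hp⟩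
    simp only [Δ, LinearMap.coe_mk, AddHom.coe_mk, Pi.zero_apply] at this
    simp only [extendβ, dif_pos hp, symOf]
    exact this
  have hΛβ : ∀ c : Sym2 (Fin d) → ℂ, ∀ A : Finset (Fin h), A ⊆ T → A.Nonempty → A.card ≤ q →
      ∀ p' ∈ S, ∑ p ∈ S, extendβ S (symOf S v c) p p' * ∏ a ∈ A, tx (some p) a = 0 := by
    intro c A hAT hA hAq p' hp'
    have hAidx : A ∈ verIdx T q := by
      simp only [verIdx, Finset.mem_filter, Finset.mem_powerset]; exact ⟨hAT, hA, hAq⟩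
    rw [← Finset.sum_attach S]
    have hrw : ∀ p : ↥S, extendβ S (symOf S v c) p p' * ∏ a ∈ A, tx (some (p : Fin K)) a =
        ∑ i, (∑ j, c s(i, j) * v j ⟨p', hp'⟩) * ((∏ a ∈ A, tx (some (p : Fin K)) a) * v i p) := by
      intro p
      simp only [extendβ, dif_pos p.2, dif_pos hp', symOf]
      rw [Finset.sum_mul]
      refine Finset.sum_congr rfl fun i _ => ?_
      rw [Finset.sum_mul, Finset.sum_mul]
      exact Finset.sum_congr rfl fun j _ => by ring
    have hattach : ∑ p ∈ S.attach, extendβ S (symOf S v c) p p' * ∏ a ∈ A, tx (some (p : Fin K)) a =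
        ∑ p : ↥S, extendβ S (symOf S v c) p p' * ∏ a ∈ A, tx (some (p : Fin K)) a := rfl
    rw [hattach]
    simp_rw [hrw]
    rw [Finset.sum_comm]
    refine Finset.sum_eq_zero fun i _ => ?_
    rw [← Finset.mul_sum, hvΛ i ⟨A, hAidx⟩, mul_zero]
  -- L is injective
  have hLapply : ∀ c : ↥(LinearMap.ker Δ), L c = relVec e S (extendβ S (symOf S v (c : Sym2 (Fin d) → ℂ))) := fun c => rfl
  have hLinj : Function.Injective L := by
    rw [← LinearMap.ker_eq_bot, LinearMap.ker_eq_bot']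
    intro c hc
    rw [hLapply] at hc
    -- no nonzero entry, else relVec ≠ 0
    have hall : ∀ p ∈ S, ∀ p' ∈ S, extendβ S (symOf S v (c : Sym2 (Fin d) → ℂ)) p p' = 0 := by
      by_contra hnone
      push Not at hnone
      obtain ⟨p, hp, p', hp', hne⟩ := hnone
      exact relVec_ne_zero e S _ h2 (hsymβ c) (hdiagβ c) ⟨p, hp, p', hp', hne⟩ hc
    have hzero : symOf S v (c : Sym2 (Fin d) → ℂ) = 0 := by
      funext p p'
      have := hall p p.2 p' p'.2
      simpa [extendβ, dif_pos p.2, dif_pos p'.2] using this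
    have hc0 : (c : Sym2 (Fin d) → ℂ) = 0 := symOf_eq_zero S v hv _ hzero
    exact Subtype.ext hc0
  -- the image of L lies in the kernel of the matrix
  have hrange : LinearMap.range L ≤ LinearMap.ker Mx.mulVecLin := by
    rintro x ⟨c, rfl⟩
    rw [LinearMap.mem_ker, Matrix.mulVecLin_apply, hLapply, hMx]
    exact mulVec_relVec_of_vanishing tx u e he S _ h0 h1 h2 (hdiagβ c)
      (fun i => sum_secondDiff_eq_zero_veronese tx S T _ q (hsymβ c) (hΛβ c) (u i) (hrows i).1 (hrows i).2)
  -- rank–nullity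
  have hrn := Mx.mulVecLin.finrank_range_add_finrank_ker
  rw [Module.finrank_fintype_fun_eq_card] at hrn
  have hrank : Mx.rank = finrank ℂ (LinearMap.range Mx.mulVecLin) := rfl
  have hLrange : finrank ℂ (LinearMap.range L) = finrank ℂ ↥(LinearMap.ker Δ) := LinearMap.finrank_range_of_inj hLinj
  have hmono : finrank ℂ (LinearMap.range L) ≤ finrank ℂ (LinearMap.ker Mx.mulVecLin) := Submodule.finrank_mono hrange
  omega

/-- **q = 1 form**: rows of size ≤ 3 inside `T`, complete pair ball on `S` with origin among the columns ⇒
`rank + (C(|S| − |T| + 1, 2) − |S|) ≤ |n|`. -/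
theorem rank_add_le_card_pairs (tx : Option (Fin K) → Fin h → ℂ) (u : n → Finset (Fin h)) (e : n → Finset (Fin K))
    (he : Function.Injective e) (S : Finset (Fin K)) (T : Finset (Fin h))
    (h0 : ∃ k, e k = ∅) (h1 : ∀ p ∈ S, ∃ k, e k = {p}) (h2 : ∀ p ∈ S, ∀ p' ∈ S, p ≠ p' → ∃ k, e k = insert p {p'})
    (hrows : ∀ i, u i ⊆ T ∧ (u i).card ≤ 3) :
    (Matrix.of fun i k : n => ∏ a ∈ u i, (tx none a + ∑ p ∈ e k, tx (some p) a)).rank +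
      (Nat.choose (S.card - T.card + 1) 2 - S.card) ≤ Fintype.card n := by
  classical
  have hidx : (verIdx T 1).card = T.card := by
    have hset : verIdx T 1 = T.powersetCard 1 := by
      ext A
      simp only [verIdx, Finset.mem_filter, Finset.mem_powerset, Finset.mem_powersetCard]
      constructor
      · rintro ⟨hAT, hA, hA1⟩
        exact ⟨hAT, le_antisymm hA1 (Finset.card_pos.mpr hA)⟩
      · rintro ⟨hAT, hA1⟩
        exact ⟨hAT, Finset.card_pos.mp (by omega), hA1.le⟩
    rw [hset, Finset.card_powersetCard, Nat.choose_one_right]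
  have hmain := rank_add_le_card tx u e he S T 1 h0 h1 h2 (fun i => ⟨(hrows i).1, by have := (hrows i).2; omega⟩)
  rw [hidx] at hmain
  exact hmain

end SymSyzygy

end

end Summit.ValiantsHypothesis.ValiantsHypothesis.Theorems.BarrierLever.HiddenStates
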